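import Summits.CriticalPhenomena.PercolationContinuityZ3.Theorems.PercNearOneGluingNoHeavyQuantSliceLawSWCells
import HarnessLib

/-!
# QUANT lane R8, T-DEC: towards `LawDec.SliceLawSW` — part 4: the NUMERICS of the core case (the transfer `t` and the flow amounts, light pair,
# `h` a true mid of the slice, `h′ = h`)

builds on p205010 (kernel theorem, internal audit signed; external expert review pending)

Support file (`--supports stmt-CriticalPhenomena-4575`), QUANT lane typer seat prim-quant-stmt (gen 24), rung R8 of
`run/shared/lean/prim/quant/LADDER.md`.  Theorems only (real variables), standard axioms, no sorries.  Parts 1–3: `…QuantSliceLawSWFlow`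
(`swLawAt_decAtT_of_flow`, `FlowAtT.shift_absorber_up`), `…QuantSliceLawSWPoly` (certificates), `…QuantSliceLawSWCells` (`sw_*` inequalities).

Coordinates: `0 < ρ < x ≤ g < 1`, sizes `a, D > 0` (`D = h − l`), `C = ρD + ag` (`= T′ − 2l`), window mid `C ≤ 2D`; `γ = x² + (1−x)ρ`; masses `m₀ = (1−γ)(1−g)`
(low `l`), `m₁ = (1−γ)g` (`l + a`: low iff `2a < C`), `m_d = γ(1−g)` (`h`), `m_G = γg` (giant `h + a`); closed rates `u₁` (pair `(l+a,h)`, light), `u_{0d}`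
(pair `(l,h)` at `T′`: light form when `C ≤ xD`, heavy form `C/(D−C)` when `xD ≤ C`), `u_{01} = C/(a−C)` (pair `(l,l+a)`), `x/(1−x)` (giant).
* **`sw_numerics_H`** (`xD ≤ C`) and **`sw_numerics_L`** (`C ≤ xD`) — there are a transfer `t` (`0 ≤ t(1−g) ≤ m_G`) and amounts `F₁` (`l+a ↦ h`, only
  when `l + a` is low), `F₂` (`l ↦ h`, only when `C < D`), `F₃` (`l ↦ l+a`, only when `l + a` is an absorber and `C < a`) with `F₂ + F₃ ≤ m₀`,
  the mid inequality `u₁F₁ + u_{0d}F₂ ≤ (γ + t)(1−g)`, `u_{01}F₃ ≤ m₁`, and the giant inequality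
  `x/(1−x)·([2a < C](m₁ − F₁) + m₀ − F₂ − F₃) ≤ m_G − t(1−g)` — the corner strategy of the merged problem read back as a transfer: side H: `l + a`
  into `h` first (`t` = its overflow over `m_d`, cell DA; if it fits, `l` takes the rest of `h` at the heavy rate, cells DAinc/DA2H), shallow: `l` fills
  `l + a`, then `h`, then the giant (cells S_H_*, S_inc_*); side L: everything into `h` with the full transfer (cells DB, S_*_L).
Part 5 (`…QuantSliceLawSWCore`) feeds these into `swLawAt_decAtT_of_flow`.

[this work]; memo SINGLE-LAYER-G55 §3b–§3c (census-2 g55).  Nothing here is cited as a published result.  The gluing rows served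
[cite: KozmaNitzan2024, Conjecture 3 (p. 15)]; product measure [cite: Grimmett1999, §1.3 p. 10].
-/

noncomputable section

namespace Summit.CriticalPhenomena.PercolationContinuityZ3.Theorems

namespace Quant

open Finset

namespace LawDec

section Numerics

variable (x ρ g a D : ℝ)

/-- **numerics of the core case, side H** (`xD ≤ C`: the pair `(l, h)` is heavy or dead at `T′`). [this work] -/
theorem sw_numerics_H (hx0 : 0 < x) (hx1 : x < 1) (hr0 : 0 < ρ) (hrx : ρ < x) (hxg : x ≤ g) (hg1 : g < 1) (ha0 : 0 < a) (hD0 : 0 < D)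
    (hmidW : ρ * D + a * g ≤ 2 * D) (hside : x * D ≤ ρ * D + a * g) :
    ∃ t F₁ F₂ F₃ : ℝ, 0 ≤ t ∧ t * (1 - g) ≤ (x ^ 2 + (1 - x) * ρ) * g ∧
      0 ≤ F₁ ∧ F₁ ≤ (1 - (x ^ 2 + (1 - x) * ρ)) * g ∧ (0 < F₁ → 2 * a < ρ * D + a * g) ∧
      0 ≤ F₂ ∧ (0 < F₂ → ρ * D + a * g < D) ∧
      0 ≤ F₃ ∧ (0 < F₃ → ρ * D + a * g ≤ 2 * a ∧ ρ * D + a * g < a) ∧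
      F₂ + F₃ ≤ (1 - (x ^ 2 + (1 - x) * ρ)) * (1 - g) ∧
      (x ^ 2 * (D - a) + (1 - x) * ((ρ * D + a * g) - 2 * a)) / ((1 - x) * ((1 + x) * (D - a) - ((ρ * D + a * g) - 2 * a))) * F₁
        + (ρ * D + a * g) / (D - (ρ * D + a * g)) * F₂ ≤ ((x ^ 2 + (1 - x) * ρ) + t) * (1 - g) ∧
      (ρ * D + a * g) / (a - (ρ * D + a * g)) * F₃ ≤ (1 - (x ^ 2 + (1 - x) * ρ)) * g ∧
      x / (1 - x) * ((if 2 * a < ρ * D + a * g then (1 - (x ^ 2 + (1 - x) * ρ)) * g - F₁ else 0)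
          + ((1 - (x ^ 2 + (1 - x) * ρ)) * (1 - g) - F₂ - F₃))
        ≤ (x ^ 2 + (1 - x) * ρ) * g - t * (1 - g) := by
  have h1x : 0 < 1 - x := sub_pos.2 hx1
  have h1g : 0 < 1 - g := sub_pos.2 hg1
  have hg0 : 0 < g := hx0.trans_le hxg
  have hgam : 0 < x ^ 2 + (1 - x) * ρ := by nlinarith [mul_pos h1x hr0, pow_pos hx0 2]
  have hgam1 : x ^ 2 + (1 - x) * ρ < 1 := by nlinarith [mul_lt_mul_of_pos_left hrx h1x]
  have hC0 : 0 < ρ * D + a * g := by nlinarith [mul_pos hr0 hD0, mul_pos ha0 hg0]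
  have hxx : 0 < x / (1 - x) := div_pos hx0 h1x
  set γ' := x ^ 2 + (1 - x) * ρ with hγ'
  set C := ρ * D + a * g with hC
  set U1 := (x ^ 2 * (D - a) + (1 - x) * (C - 2 * a)) / ((1 - x) * ((1 + x) * (D - a) - (C - 2 * a))) with hU1
  set UH := C / (D - C) with hUH
  set U01 := C / (a - C) with hU01
  set ux := x / (1 - x) with hux
  have hm0 : 0 ≤ (1 - γ') * (1 - g) := mul_nonneg (by linarith) h1g.le
  have hm1 : 0 ≤ (1 - γ') * g := mul_nonneg (by linarith) hg0.le
  have hmd : 0 ≤ γ' * (1 - g) := mul_nonneg hgam.le h1g.le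
  have hmG : 0 ≤ γ' * g := mul_nonneg hgam.le hg0.le
  by_cases hdeep : 2 * a < C
  · -- deep: `l + a` is low and ships into `h` at the light anti-diagonal rate `U1 ≥ 0`
    have hDa : a < D := by nlinarith
    have hU10 : 0 ≤ U1 := by
      rw [hU1]
      refine div_nonneg ?_ (mul_pos h1x (by nlinarith [mul_pos hx0 (sub_pos.2 hDa)])).le
      nlinarith [mul_pos (pow_pos hx0 2) (sub_pos.2 hDa)]
    by_cases hsat : γ' * (1 - g) ≤ U1 * ((1 - γ') * g)
    · -- `l + a` saturates `h`: the transfer carries the overflow; `l` rides the giant (cell DA = (I-A))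
      have hA : 0 ≤ γ' - U1 * ((1 - γ') * g) - ux * ((1 - γ') * (1 - g)) :=
        sw_DA x ρ g a D hx0 hx1 hr0 hrx hxg hg1.le ha0 hD0 hmidW hdeep hside
      refine ⟨(U1 * ((1 - γ') * g) - γ' * (1 - g)) / (1 - g), (1 - γ') * g, 0, 0, div_nonneg (by linarith) h1g.le, ?_, hm1, le_rfl,
        fun _ => hdeep, le_rfl, fun h => absurd h (lt_irrefl 0), le_rfl, fun h => absurd h (lt_irrefl 0), by rw [add_zero]; exact hm0, ?_,
        by rw [mul_zero]; exact hm1, ?_⟩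
      · rw [div_mul_cancel₀ _ h1g.ne']; nlinarith [mul_nonneg hxx.le hm0]
      · rw [mul_zero, add_zero, add_mul, div_mul_cancel₀ _ h1g.ne']; linarith
      · rw [if_pos hdeep, div_mul_cancel₀ _ h1g.ne']; linarith
    · push Not at hsat
      -- `l + a` fits into `h` with no transfer
      by_cases hCD : C < D
      · -- `l` may use the rest of `h` at the heavy rate `UH > 0`
        have hUH0 : 0 < UH := by rw [hUH]; exact div_pos hC0 (by linarith)
        set cap := (γ' * (1 - g) - U1 * ((1 - γ') * g)) / UH with hcap
        have hcap0 : 0 ≤ cap := div_nonneg (by linarith) hUH0.le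
        have hcapmid : UH * cap = γ' * (1 - g) - U1 * ((1 - γ') * g) := by rw [hcap]; field_simp
        by_cases hfit2 : (1 - γ') * (1 - g) ≤ cap
        · -- everything fits: the giant carries nothing
          refine ⟨0, (1 - γ') * g, (1 - γ') * (1 - g), 0, le_rfl, by rw [zero_mul]; exact hmG, hm1, le_rfl, fun _ => hdeep, hm0,
            fun _ => hCD, le_rfl, fun h => absurd h (lt_irrefl 0), by rw [add_zero], ?_, by rw [mul_zero]; exact hm1, ?_⟩
          · have := mul_le_mul_of_nonneg_left hfit2 hUH0.le
            rw [add_zero]; linarith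
          · rw [if_pos hdeep]
            linarith [hmG]
        · push Not at hfit2
          have h2 : 0 ≤ γ' * g - ux * ((1 - γ') * (1 - g) - (γ' * (1 - g) - U1 * ((1 - γ') * g)) / UH) :=
            sw_DA2H x ρ g a D hx0 hx1 hr0 hrx hxg hg1.le ha0 hD0 hmidW hdeep hCD hside hsat.le
          refine ⟨0, (1 - γ') * g, cap, 0, le_rfl, by rw [zero_mul]; exact hmG, hm1, le_rfl, fun _ => hdeep, hcap0, fun _ => hCD, le_rfl,
            fun h => absurd h (lt_irrefl 0), by rw [add_zero]; exact hfit2.le, by rw [add_zero]; linarith, by rw [mul_zero]; exact hm1, ?_⟩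
          rw [if_pos hdeep, hcap]
          linarith
      · -- `l` cannot use `h`: it rides the giant (cell DAinc)
        push Not at hCD
        have h3 : 0 ≤ γ' * g - ux * ((1 - γ') * (1 - g)) := sw_DAinc x ρ g a D hx0 hx1 hr0 hrx hxg hg1.le ha0 hD0 hmidW hdeep hCD
        refine ⟨0, (1 - γ') * g, 0, 0, le_rfl, by rw [zero_mul]; exact hmG, hm1, le_rfl, fun _ => hdeep, le_rfl, fun h => absurd h (lt_irrefl 0),
          le_rfl, fun h => absurd h (lt_irrefl 0), by rw [add_zero]; exact hm0, by rw [mul_zero, add_zero, add_zero]; exact hsat.le,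
          by rw [mul_zero]; exact hm1, ?_⟩
        rw [if_pos hdeep]
        linarith
  · -- shallow: only `l` is low; `l + a` absorbs at the heavy rate `U01` when `C < a`, `h` at `UH` when `C < D`, the rest rides the giant
    push Not at hdeep
    by_cases hCa : C < a
    · have hU010 : 0 < U01 := by rw [hU01]; exact div_pos hC0 (by linarith)
      set cap1 := ((1 - γ') * g) / U01 with hcap1
      have hcap10 : 0 ≤ cap1 := div_nonneg hm1 hU010.le
      have hcap1mid : U01 * cap1 = (1 - γ') * g := by rw [hcap1]; field_simp
      by_cases hf3 : (1 - γ') * (1 - g) ≤ cap1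
      · -- `l` fits into `l + a`
        refine ⟨0, 0, 0, (1 - γ') * (1 - g), le_rfl, by rw [zero_mul]; exact hmG, le_rfl, hm1, fun h => absurd h (lt_irrefl 0), le_rfl,
          fun h => absurd h (lt_irrefl 0), hm0, fun _ => ⟨hdeep, hCa⟩, by rw [zero_add], ?_, ?_, ?_⟩
        · rw [mul_zero, mul_zero, add_zero, add_zero]; exact hmd
        · have := mul_le_mul_of_nonneg_left hf3 hU010.le; linarith
        · rw [if_neg (not_lt.2 hdeep)]
          linarith [hmG]
      · push Not at hf3
        by_cases hCD : C < D
        · have hUH0 : 0 < UH := by rw [hUH]; exact div_pos hC0 (by linarith)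
          set cap2 := (γ' * (1 - g)) / UH with hcap2
          have hcap20 : 0 ≤ cap2 := div_nonneg hmd hUH0.le
          have hcap2mid : UH * cap2 = γ' * (1 - g) := by rw [hcap2]; field_simp
          by_cases hf2 : (1 - γ') * (1 - g) - cap1 ≤ cap2
          · -- the rest of `l` fits into `h`
            refine ⟨0, 0, (1 - γ') * (1 - g) - cap1, cap1, le_rfl, by rw [zero_mul]; exact hmG, le_rfl, hm1, fun h => absurd h (lt_irrefl 0),
              by linarith, fun _ => hCD, hcap10, fun _ => ⟨hdeep, hCa⟩, by linarith, ?_, by rw [hcap1mid], ?_⟩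
            · have := mul_le_mul_of_nonneg_left hf2 hUH0.le
              rw [mul_zero, zero_add, add_zero]; linarith
            · rw [if_neg (not_lt.2 hdeep)]
              linarith [hmG]
          · push Not at hf2
            have h4 : 0 ≤ ((1 - γ') * g) / U01 + (γ' * (1 - g)) / UH + (γ' * g) / ux - (1 - γ') * (1 - g) :=
              sw_S_H_H x ρ g a D hx0 hx1 hr0 hrx hxg hg1.le ha0 hD0 hmidW hdeep hCa hCD hside
            refine ⟨0, 0, cap2, cap1, le_rfl, by rw [zero_mul]; exact hmG, le_rfl, hm1, fun h => absurd h (lt_irrefl 0), hcap20, fun _ => hCD,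
              hcap10, fun _ => ⟨hdeep, hCa⟩, by linarith, by rw [mul_zero, zero_add, add_zero, hcap2mid], by rw [hcap1mid], ?_⟩
            rw [if_neg (not_lt.2 hdeep)]
            have e : (γ' * g) / ux = γ' * g / x * (1 - x) := by rw [hux]; field_simp
            have hkey : ux * ((1 - γ') * (1 - g) - cap2 - cap1) ≤ γ' * g := by
              have : (1 - γ') * (1 - g) - cap2 - cap1 ≤ (γ' * g) / ux := by rw [hcap1, hcap2]; linarith
              have := mul_le_mul_of_nonneg_left this hxx.le
              rw [mul_div_cancel₀ _ hxx.ne'] at this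
              linarith
            linarith [hkey]
        · push Not at hCD
          have h5 : 0 ≤ ((1 - γ') * g) / U01 + (γ' * g) / ux - (1 - γ') * (1 - g) :=
            sw_S_H_inc x ρ g a D hx0 hx1 hr0 hrx hxg hg1.le ha0 hD0 hmidW hdeep hCa hCD
          refine ⟨0, 0, 0, cap1, le_rfl, by rw [zero_mul]; exact hmG, le_rfl, hm1, fun h => absurd h (lt_irrefl 0), le_rfl,
            fun h => absurd h (lt_irrefl 0), hcap10, fun _ => ⟨hdeep, hCa⟩, by linarith, ?_, by rw [hcap1mid], ?_⟩
          · rw [mul_zero, mul_zero, add_zero, add_zero]; exact hmd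
          · rw [if_neg (not_lt.2 hdeep)]
            have : (1 - γ') * (1 - g) - cap1 ≤ (γ' * g) / ux := by rw [hcap1]; linarith
            have := mul_le_mul_of_nonneg_left this hxx.le
            rw [mul_div_cancel₀ _ hxx.ne'] at this
            linarith
    · push Not at hCa
      by_cases hCD : C < D
      · have hUH0 : 0 < UH := by rw [hUH]; exact div_pos hC0 (by linarith)
        set cap2 := (γ' * (1 - g)) / UH with hcap2
        have hcap20 : 0 ≤ cap2 := div_nonneg hmd hUH0.le
        have hcap2mid : UH * cap2 = γ' * (1 - g) := by rw [hcap2]; field_simp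
        by_cases hf2 : (1 - γ') * (1 - g) ≤ cap2
        · refine ⟨0, 0, (1 - γ') * (1 - g), 0, le_rfl, by rw [zero_mul]; exact hmG, le_rfl, hm1, fun h => absurd h (lt_irrefl 0), hm0,
            fun _ => hCD, le_rfl, fun h => absurd h (lt_irrefl 0), by rw [add_zero], ?_, by rw [mul_zero]; exact hm1, ?_⟩
          · have := mul_le_mul_of_nonneg_left hf2 hUH0.le
            rw [mul_zero, zero_add, add_zero]; linarith
          · rw [if_neg (not_lt.2 hdeep)]
            linarith [hmG]
        · push Not at hf2
          have h6 : 0 ≤ (γ' * (1 - g)) / UH + (γ' * g) / ux - (1 - γ') * (1 - g) :=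
            sw_S_inc_H x ρ g a D hx0 hx1 hr0 hrx hxg hg1.le ha0 hD0 hmidW hdeep hCa hCD hside
          refine ⟨0, 0, cap2, 0, le_rfl, by rw [zero_mul]; exact hmG, le_rfl, hm1, fun h => absurd h (lt_irrefl 0), hcap20, fun _ => hCD,
            le_rfl, fun h => absurd h (lt_irrefl 0), by rw [add_zero]; exact hf2.le, by rw [mul_zero, zero_add, add_zero, hcap2mid],
            by rw [mul_zero]; exact hm1, ?_⟩
          rw [if_neg (not_lt.2 hdeep)]
          have : (1 - γ') * (1 - g) - cap2 ≤ (γ' * g) / ux := by rw [hcap2]; linarith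
          have := mul_le_mul_of_nonneg_left this hxx.le
          rw [mul_div_cancel₀ _ hxx.ne'] at this
          linarith
      · push Not at hCD
        have h7 : 0 ≤ (γ' * g) / ux - (1 - γ') * (1 - g) :=
          sw_S_inc_inc x ρ g a D hx0 hx1 hr0 hrx hxg hg1.le ha0 hD0 hmidW hdeep hCa hCD
        refine ⟨0, 0, 0, 0, le_rfl, by rw [zero_mul]; exact hmG, le_rfl, hm1, fun h => absurd h (lt_irrefl 0), le_rfl,
          fun h => absurd h (lt_irrefl 0), le_rfl, fun h => absurd h (lt_irrefl 0), by rw [add_zero]; exact hm0, ?_,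
          by rw [mul_zero]; exact hm1, ?_⟩
        · rw [mul_zero, mul_zero, add_zero, add_zero]; exact hmd
        · rw [if_neg (not_lt.2 hdeep)]
          have : (1 - γ') * (1 - g) ≤ (γ' * g) / ux := by linarith
          have := mul_le_mul_of_nonneg_left this hxx.le
          rw [mul_div_cancel₀ _ hxx.ne'] at this
          linarith

/-- **numerics of the core case, side L** (`C ≤ xD`: the pair `(l, h)` is light at `T′`; then `C < D` and everything goes into `h`). [this work] -/
theorem sw_numerics_L (hx0 : 0 < x) (hx1 : x < 1) (hr0 : 0 < ρ) (hrx : ρ < x) (hxg : x ≤ g) (hg1 : g < 1) (ha0 : 0 < a) (hD0 : 0 < D)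
    (hmidW : ρ * D + a * g ≤ 2 * D) (hside : ρ * D + a * g ≤ x * D) :
    ∃ t F₁ F₂ F₃ : ℝ, 0 ≤ t ∧ t * (1 - g) ≤ (x ^ 2 + (1 - x) * ρ) * g ∧
      0 ≤ F₁ ∧ F₁ ≤ (1 - (x ^ 2 + (1 - x) * ρ)) * g ∧ (0 < F₁ → 2 * a < ρ * D + a * g) ∧
      0 ≤ F₂ ∧ (0 < F₂ → ρ * D + a * g < D) ∧
      0 ≤ F₃ ∧ (0 < F₃ → ρ * D + a * g ≤ 2 * a ∧ ρ * D + a * g < a) ∧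
      F₂ + F₃ ≤ (1 - (x ^ 2 + (1 - x) * ρ)) * (1 - g) ∧
      (x ^ 2 * (D - a) + (1 - x) * ((ρ * D + a * g) - 2 * a)) / ((1 - x) * ((1 + x) * (D - a) - ((ρ * D + a * g) - 2 * a))) * F₁
        + (x ^ 2 * D + (1 - x) * (ρ * D + a * g)) / ((1 - x) * ((1 + x) * D - (ρ * D + a * g))) * F₂
          ≤ ((x ^ 2 + (1 - x) * ρ) + t) * (1 - g) ∧
      (ρ * D + a * g) / (a - (ρ * D + a * g)) * F₃ ≤ (1 - (x ^ 2 + (1 - x) * ρ)) * g ∧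
      x / (1 - x) * ((if 2 * a < ρ * D + a * g then (1 - (x ^ 2 + (1 - x) * ρ)) * g - F₁ else 0)
          + ((1 - (x ^ 2 + (1 - x) * ρ)) * (1 - g) - F₂ - F₃))
        ≤ (x ^ 2 + (1 - x) * ρ) * g - t * (1 - g) := by
  have h1x : 0 < 1 - x := sub_pos.2 hx1
  have h1g : 0 < 1 - g := sub_pos.2 hg1
  have hg0 : 0 < g := hx0.trans_le hxg
  have hgam : 0 < x ^ 2 + (1 - x) * ρ := by nlinarith [mul_pos h1x hr0, pow_pos hx0 2]
  have hgam1 : x ^ 2 + (1 - x) * ρ < 1 := by nlinarith [mul_lt_mul_of_pos_left hrx h1x]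
  have hC0 : 0 < ρ * D + a * g := by nlinarith [mul_pos hr0 hD0, mul_pos ha0 hg0]
  have hxD : x * D < D := by nlinarith
  have hCD : ρ * D + a * g < D := by linarith
  set γ' := x ^ 2 + (1 - x) * ρ with hγ'
  set C := ρ * D + a * g with hC
  set U1 := (x ^ 2 * (D - a) + (1 - x) * (C - 2 * a)) / ((1 - x) * ((1 + x) * (D - a) - (C - 2 * a))) with hU1
  set UL := (x ^ 2 * D + (1 - x) * C) / ((1 - x) * ((1 + x) * D - C)) with hUL
  set U01 := C / (a - C) with hU01
  set ux := x / (1 - x) with hux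
  have hm0 : 0 ≤ (1 - γ') * (1 - g) := mul_nonneg (by linarith) h1g.le
  have hm1 : 0 ≤ (1 - γ') * g := mul_nonneg (by linarith) hg0.le
  have hmd : 0 ≤ γ' * (1 - g) := mul_nonneg hgam.le h1g.le
  have hmG : 0 ≤ γ' * g := mul_nonneg hgam.le hg0.le
  have hUL0 : 0 < UL := by
    rw [hUL]
    exact div_pos (by nlinarith [mul_pos (pow_pos hx0 2) hD0, mul_pos h1x hC0]) (mul_pos h1x (by nlinarith [mul_pos hx0 hD0]))
  by_cases hdeep : 2 * a < C
  · -- deep: both lows into `h`, the transfer carries the overflow (cell DB = (I-B))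
    have hDa : a < D := by nlinarith
    have hU10 : 0 ≤ U1 := by
      rw [hU1]
      refine div_nonneg ?_ (mul_pos h1x (by nlinarith [mul_pos hx0 (sub_pos.2 hDa)])).le
      nlinarith [mul_pos (pow_pos hx0 2) (sub_pos.2 hDa)]
    have hB : 0 ≤ γ' - U1 * ((1 - γ') * g) - UL * ((1 - γ') * (1 - g)) :=
      sw_DB x ρ g a D hx0 hx1 hr0 hrx hxg hg1.le ha0 hD0 hmidW hdeep hside
    set ov := U1 * ((1 - γ') * g) + UL * ((1 - γ') * (1 - g)) - γ' * (1 - g) with hov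
    refine ⟨max 0 ov / (1 - g), (1 - γ') * g, (1 - γ') * (1 - g), 0, div_nonneg (le_max_left _ _) h1g.le, ?_, hm1, le_rfl, fun _ => hdeep,
      hm0, fun _ => hCD, le_rfl, fun h => absurd h (lt_irrefl 0), by rw [add_zero], ?_, by rw [mul_zero]; exact hm1, ?_⟩
    · rw [div_mul_cancel₀ _ h1g.ne']
      refine max_le hmG ?_
      rw [hov]; linarith
    · rw [add_mul, div_mul_cancel₀ _ h1g.ne']
      have := le_max_right 0 ov
      rw [hov] at this
      linarith
    · rw [if_pos hdeep, div_mul_cancel₀ _ h1g.ne']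
      have hmax : max 0 ov ≤ γ' * g := max_le hmG (by rw [hov]; linarith)
      linarith
  · -- shallow: full transfer, `l` fills `l + a` (when compatible) and then `h`
    push Not at hdeep
    have htfull : γ' * g / (1 - g) * (1 - g) = γ' * g := div_mul_cancel₀ _ h1g.ne'
    by_cases hCa : C < a
    · have hU010 : 0 < U01 := by rw [hU01]; exact div_pos hC0 (by linarith)
      set cap1 := ((1 - γ') * g) / U01 with hcap1
      have hcap10 : 0 ≤ cap1 := div_nonneg hm1 hU010.le
      have hcap1mid : U01 * cap1 = (1 - γ') * g := by rw [hcap1]; field_simp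
      by_cases hf3 : (1 - γ') * (1 - g) ≤ cap1
      · refine ⟨γ' * g / (1 - g), 0, 0, (1 - γ') * (1 - g), div_nonneg hmG h1g.le, by rw [htfull], le_rfl, hm1,
          fun h => absurd h (lt_irrefl 0), le_rfl, fun h => absurd h (lt_irrefl 0), hm0, fun _ => ⟨hdeep, hCa⟩, by rw [zero_add], ?_, ?_, ?_⟩
        · rw [mul_zero, mul_zero, add_zero, add_mul, htfull]; nlinarith
        · have := mul_le_mul_of_nonneg_left hf3 hU010.le; linarith
        · rw [if_neg (not_lt.2 hdeep)]
          linarith [hmG, htfull]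
      · push Not at hf3
        have h8 : 0 ≤ ((1 - γ') * g) / U01 + γ' / UL - (1 - γ') * (1 - g) :=
          sw_S_H_L x ρ g a D hx0 hx1 hr0 hrx hxg hg1.le ha0 hD0 hmidW hdeep hCa hside
        refine ⟨γ' * g / (1 - g), 0, (1 - γ') * (1 - g) - cap1, cap1, div_nonneg hmG h1g.le, by rw [htfull], le_rfl, hm1,
          fun h => absurd h (lt_irrefl 0), by linarith, fun _ => hCD, hcap10, fun _ => ⟨hdeep, hCa⟩, by linarith, ?_, by rw [hcap1mid], ?_⟩
        · rw [mul_zero, zero_add, add_mul, htfull]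
          have hle : (1 - γ') * (1 - g) - cap1 ≤ γ' / UL := by rw [hcap1]; linarith
          have := mul_le_mul_of_nonneg_left hle hUL0.le
          rw [mul_div_cancel₀ _ hUL0.ne'] at this
          linarith
        · rw [if_neg (not_lt.2 hdeep)]
          linarith [hmG, htfull]
    · push Not at hCa
      have h9 : 0 ≤ γ' / UL - (1 - γ') * (1 - g) := sw_S_inc_L x ρ g a D hx0 hx1 hr0 hrx hxg hg1.le ha0 hD0 hmidW hdeep hCa hside
      refine ⟨γ' * g / (1 - g), 0, (1 - γ') * (1 - g), 0, div_nonneg hmG h1g.le, by rw [htfull], le_rfl, hm1,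
        fun h => absurd h (lt_irrefl 0), hm0, fun _ => hCD, le_rfl, fun h => absurd h (lt_irrefl 0), by rw [add_zero], ?_,
        by rw [mul_zero]; exact hm1, ?_⟩
      · rw [mul_zero, zero_add, add_mul, htfull]
        have hle : (1 - γ') * (1 - g) ≤ γ' / UL := by linarith
        have := mul_le_mul_of_nonneg_left hle hUL0.le
        rw [mul_div_cancel₀ _ hUL0.ne'] at this
        linarith
      · rw [if_neg (not_lt.2 hdeep)]
        linarith [hmG, htfull]

end Numerics

end LawDec

end Quant

end Summit.CriticalPhenomena.PercolationContinuityZ3.Theorems
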